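import Mathlib
import Summits.ResolutionOfSingularities.ResolutionOfSingularities.Theorems.RadicialJungCleanModelsCleanLU2OfRegularAffine
import Summits.ResolutionOfSingularities.ResolutionOfSingularities.Theorems.RadicialJungCleanModelsCleanLU2RegularAffineModel
import Literature.AlgebraicGeometry.Resolution.AffineDomainDimension
import Literature.AlgebraicGeometry.CossartPiltant200819.Cor46Cofinality2008
import HarnessLib

/-!
# Route `RadicialJung`, crux `CleanModels` (stmt-ResolutionOfSingularities-15917), skeleton `Cruxes/CleanModels/Lines/Sketch.lean` rev 35:
# the graded zero-dimensional LOCAL input `CleanLUZeroDim_d` is NECESSARY — it follows from `CleanModels` restricted to `dim W ≤ N` (`d ≤ N`)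
# by extraction along the valuation (dimension-free form of the lead's ✓ `cleanRegAt_of_regularAffineModel`, which is `N = 2` over F-75c)

Explicit-unit seat `decomp-res-hand-2` g7 (share = stubs 5–7, strategy «structural»).  OURS, def-free, route-independent (the restricted crux is a
HYPOTHESIS shape here; the by-name corollaries `CleanModels → CleanAlongValuation4` live in `…CleanAlongValuationOfCleanModels.lean`); nothing here
proves resolution of singularities in characteristic `p`.

* `exists_regularAffineModel_of_regularAtCentre_dimLE` — a finitely generated model regular at the centre of `Ō` shrinks to a REGULAR affine model
  `Ā[f⁻¹] ⊆ Ō` of the same dimension bound (J-2 for fields ✓ `isOpen_regularLocus_of_finiteType_field`, ✓ `isRegularRing_adjoin_insert_inv`;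
  the lead's ✓ `exists_regularAffineModel_of_regularAtCentre` without its zero-dimensionality / `dim = 2` hypotheses);
* `cleanRegAt_of_cleanModelsDimLE_regularAffineModel` — for a regular affine model `A₁ ⊆ Ō` of `κ = Frac A₁` with `dim A₁ ≤ N` and `ū ∉ κ^p`:
  `CleanModels` restricted to `dim W ≤ N` (hypothesis `hCM`, the crux's body with `topologicalKrullDim W ≤ N` added) applied to `W = Spec A₁`,
  `L = κ(ū^{1/p})`, then ✓ `exists_model_of_proper_birational` (valuative criterion + affine extraction) and transport — VERBATIM the lead's proof
  of ✓ `cleanRegAt_of_regularAffineModel` with F-75c replaced by `hCM`;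
* `cleanLUZeroDim_of_cleanModelsDimLE` — hence **`CleanModels`(dim W ≤ N) ⟹ `CleanLUZeroDim_d` for every `d ≤ N`** (the zero-dimensionality
  hypothesis is not even used): the skeleton's local input is a CONSEQUENCE of the crux, dimension by dimension.
-/

noncomputable section

set_option linter.dupNamespace false -- mandated namespace of this single-conjunct summit

open IsLocalRing AlgebraicGeometry CategoryTheory TopologicalSpace
open Literature.AlgebraicGeometry.Resolution Literature.AlgebraicGeometry.Motives
open Literature.AlgebraicGeometry.CossartPiltant200819.CP2008

namespace Summit.ResolutionOfSingularities.ResolutionOfSingularities.Theorems.RadicialJung.CleanModels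

section Extraction

open Polynomial

variable {k : Type} [Field k] {κ : Type} [Field κ] [Algebra k κ]

/-- **Regular affine shrinking, any dimension.**  A finitely generated `k`-model `Ā ⊆ Ō` of `κ = Frac Ā` whose local ring at the centre of `Ō` is
regular contains `f` of `Ō`-value `1` with `Ā[f⁻¹] ⊆ Ō` a REGULAR ring (openness of the regular locus over a field); `dim Ā[f⁻¹] = dim Ā = trdeg_k κ`.
[cite: Matsumura1987, Thm. 5.6] [folklore] -/
theorem exists_regularAffineModel_of_regularAtCentre_dimLE
    (p : ℕ) (_hp : p.Prime) (Ō : ValuationSubring κ) (Ā : Subalgebra k κ)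
    (hĀŌ : Ā.toSubring ≤ Ō.toSubring) (hĀfg : Ā.FG) (hfrac : IsFractionRing Ā κ)
    (hreg : IsRegularLocalRing (locAtCentre Ā.toSubring Ō)) {d : ℕ} (hdimĀ : ringKrullDim Ā ≤ (d : WithBot ℕ∞)) :
    ∃ (A₁ : Subalgebra k κ), A₁.toSubring ≤ Ō.toSubring ∧ Ā ≤ A₁ ∧ A₁.FG ∧ IsFractionRing A₁ κ ∧ IsRegularRing A₁ ∧
      ringKrullDim A₁ ≤ (d : WithBot ℕ∞) := by
  classical
  haveI : IsFractionRing Ā κ := hfrac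
  haveI : Algebra.FiniteType k Ā := Ā.fg_iff_finiteType.mp hĀfg
  haveI : IsNoetherianRing Ā := Algebra.FiniteType.isNoetherianRing k Ā
  -- the regular locus is open and contains the centre
  have hregOpen : IsOpen (regularLocus Ā) := isOpen_regularLocus_of_finiteType_field k Ā
  let 𝔮 := subringCentre Ā.toSubring Ō hĀŌ
  haveI : 𝔮.IsPrime := subringCentre.isPrime Ā.toSubring Ō hĀŌ
  have hreg_loc : IsRegularLocalRing (Localization.AtPrime 𝔮) := by
    rw [← isRegularLocalRing_locAtCentre_iff hĀŌ]
    exact hreg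
  let P : PrimeSpectrum Ā := ⟨𝔮, inferInstance⟩
  have hPreg : P ∈ regularLocus Ā := by
    rw [mem_regularLocus]
    exact hreg_loc
  obtain ⟨U, ⟨f, rfl⟩, hfP, hfU⟩ :=
    PrimeSpectrum.isTopologicalBasis_basic_opens.exists_subset_of_mem_open hPreg hregOpen
  have hf𝔮 : f ∉ 𝔮 := hfP
  have hvf : Ō.valuation (f : κ) = 1 := by
    have hle : Ō.valuation (f : κ) ≤ 1 := Ō.valuation_le_one ⟨f, hĀŌ f.2⟩
    have hnlt : ¬ Ō.valuation (f : κ) < 1 := fun hlt => by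
      apply hf𝔮
      rw [mem_subringCentre_iff]
      exact hlt
    exact le_antisymm hle (not_lt.mp hnlt)
  have hf0 : (f : κ) ≠ 0 := by
    intro h
    rw [h, map_zero] at hvf
    exact zero_ne_one hvf
  have hfinvO : (f : κ)⁻¹ ∈ Ō := by
    rw [← ValuationSubring.valuation_le_one_iff, map_inv₀, hvf, inv_one]
  -- trdeg bookkeeping before destructing `Ā`
  have htr : Algebra.trdeg k κ ≤ d := by
    rw [trdeg_eq_trdeg_of_isFractionRing Ā]
    obtain ⟨n, hn, htrn⟩ := exists_ringKrullDim_eq_and_trdeg_eq k Ā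
    rw [htrn]
    rw [hn] at hdimĀ
    exact_mod_cast hdimĀ
  obtain ⟨s₀, rfl⟩ := hĀfg
  let s₁ : Set κ := insert (f : κ)⁻¹ (s₀ : Set κ)
  let A₁ := Algebra.adjoin k s₁
  have hle : Algebra.adjoin k (s₀ : Set κ) ≤ A₁ := Algebra.adjoin_mono (Set.subset_insert _ _)
  have hA₁Ō : A₁.toSubring ≤ Ō.toSubring := by
    have h1 : A₁ ≤ { carrier := (Ō : Set κ)
                     mul_mem' := fun ha hb => Ō.toSubring.mul_mem ha hb
                     one_mem' := Ō.toSubring.one_mem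
                     add_mem' := fun ha hb => Ō.toSubring.add_mem ha hb
                     zero_mem' := Ō.toSubring.zero_mem
                     algebraMap_mem' := fun c => hĀŌ ((Algebra.adjoin k (s₀ : Set κ)).algebraMap_mem c) } := by
      refine Algebra.adjoin_le ?_
      rintro z (rfl | hz)
      · exact hfinvO
      · exact hĀŌ (Algebra.subset_adjoin hz)
    exact fun z hz => h1 hz
  have hfr₁ : IsFractionRing A₁ κ := by
    refine IsFractionRing.of_field A₁ κ fun z => ?_
    obtain ⟨a, b, -, hab⟩ := IsFractionRing.div_surjective (A := Algebra.adjoin k (s₀ : Set κ)) z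
    exact ⟨⟨a, hle a.2⟩, ⟨b, hle b.2⟩, hab.symm⟩
  have hA₁fg : A₁.FG := by
    refine ⟨Insert.insert (f : κ)⁻¹ s₀, ?_⟩
    simp only [Finset.coe_insert]
    rfl
  haveI : Algebra.FiniteType k A₁ := A₁.fg_iff_finiteType.mp hA₁fg
  haveI hNR₁ : IsNoetherianRing A₁ := Algebra.FiniteType.isNoetherianRing k A₁
  have hregA₁ : IsRegularRing A₁ := by
    have hfsub : (f : κ) ∈ Algebra.adjoin k (s₀ : Set κ) := f.2
    let f₀ : Algebra.adjoin k (s₀ : Set κ) := ⟨f, hfsub⟩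
    have hfU' : (PrimeSpectrum.basicOpen f₀ : Set (PrimeSpectrum (Algebra.adjoin k (s₀ : Set κ)))) ⊆
        regularLocus (Algebra.adjoin k (s₀ : Set κ)) := hfU
    exact isRegularRing_adjoin_insert_inv (s₀ : Set κ) f₀ hf0 hfU'
  have hA₁dim : ringKrullDim A₁ ≤ (d : WithBot ℕ∞) := by
    haveI := hfr₁
    exact ringKrullDim_le_of_fg_of_trdeg_le A₁ hA₁fg htr
  exact ⟨A₁, hA₁Ō, hle, hA₁fg, hfr₁, hregA₁, hA₁dim⟩

/-- **Clean local uniformization from `CleanModels` restricted to `dim W ≤ N`, by extraction along the valuation** (dimension-free form of the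
lead's ✓ `cleanRegAt_of_regularAffineModel`, which is the case `N = 2` fed with F-75c).  For a finitely generated `k`-subalgebra `A₁ ⊆ Ō` of
`κ = Frac A₁` which is a regular ring of dimension `≤ N`, and `ū ∉ κ^p`: granted the crux's conclusion for every regular integral `W/k` of
dimension `≤ N` (hypothesis `hCM`), some finitely generated `Ā' ⊇ A₁` inside `Ō` has `locAtCentre Ā' Ō` clean-regular for the `κ^p`-line of `ū`.
PROOF (verbatim the lead's): `hCM` on `W = Spec A₁` with `L = K(W)(ū^{1/p})` (`AdjoinRoot`, purely inseparable of degree `p`), then ✓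
`exists_model_of_proper_birational` (valuative criterion + affine extraction with the stalk / function-field identifications) and transport
(`LooseCleanForm.map`, `.of_ringEquiv`, ✓ `exists_model_of_isLocalBlowup`); the coefficients of `y ∈ L ∖ K(W)` in the power basis give the
representative. [folklore] -/
theorem cleanRegAt_of_cleanModelsDimLE_regularAffineModel (N : ℕ)
    (hCM : ∀ p : ℕ, p.Prime → ∀ (k : Type) [Field k] [CharP k p] (W : AlgebraicGeometry.Scheme.{0}) [AlgebraicGeometry.IsIntegral W] (f : W ⟶ AlgebraicGeometry.Spec (.of k)) (L : Type) [Field L] [Algebra W.functionField L], AlgebraicGeometry.IsSeparated f → AlgebraicGeometry.LocallyOfFiniteType f → AlgebraicGeometry.QuasiCompact f → Literature.AlgebraicGeometry.Resolution.Scheme.IsRegular W → IsPurelyInseparable W.functionField L → Module.finrank W.functionField L = p → topologicalKrullDim W ≤ ((N : ℕ) : WithBot ℕ∞) → ∃ (V : AlgebraicGeometry.Scheme.{0}) (π : V ⟶ W) (_ : AlgebraicGeometry.IsIntegral V) (_ : AlgebraicGeometry.IsDominant π), AlgebraicGeometry.IsProper π ∧ Literature.AlgebraicGeometry.Resolution.IsBirational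 π ∧ Literature.AlgebraicGeometry.Resolution.Scheme.IsRegular V ∧ (∀ v : V, (∃ (y : L) (g : W.functionField), y ∉ Set.range (algebraMap W.functionField L) ∧ algebraMap W.functionField L g = y ^ p ∧ ((∃ (d m : ℕ) (hmd : m ≤ d) (t : Fin d → V.presheaf.stalk v) (a : Fin m → ℕ), Ideal.span (Set.range t) = IsLocalRing.maximalIdeal (V.presheaf.stalk v) ∧ ringKrullDim (V.presheaf.stalk v) = (d : WithBot ℕ∞) ∧ 0 < m ∧ (∀ i, ¬ p ∣ a i) ∧ Literature.AlgebraicGeometry.Motives.RatFn.functionFieldMap π g = ∏ i : Fin m, (algebraMap (V.presheaf.stalk v) V.functionField (t (Fin.castLE hmd i))) ^ (a i)) ∨ (∃ u₀ : V.presheaf.stalk v, IsUnit u₀ ∧ Literature.AlgebraicGeometry.Motives.RatFn.functionFieldMap π g = algebraMap (V.presheaf.stalk v) V.functionField u₀ ∧ ((∀ c : V.presheaf.stalk v, u₀ - c ^ p ∉ IsLocalRing.maximalIdeal (V.presheaf.stalk v)) ∨ (∃ c : V.presheaf.stalk v, u₀ - c ^ p ∈ IsLocalRing.maximalIdeal (V.presheaf.stalk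 v) ∧ u₀ - c ^ p ∉ IsLocalRing.maximalIdeal (V.presheaf.stalk v) ^ 2)))))))
    (p : ℕ) (hp : p.Prime) [CharP k p]
    (Ō : ValuationSubring κ) (A₁ : Subalgebra k κ) (hA₁Ō : A₁.toSubring ≤ Ō.toSubring) (hA₁fg : A₁.FG)
    [IsFractionRing A₁ κ] (hregA₁ : IsRegularRing A₁) (hdimA₁ : ringKrullDim A₁ ≤ ((N : ℕ) : WithBot ℕ∞))
    (ū : κ) (hū : ∀ c : κ, c ^ p ≠ ū) :
    ∃ (Ā' : Subalgebra k κ), Ā'.toSubring ≤ Ō.toSubring ∧ A₁ ≤ Ā' ∧ Ā'.FG ∧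
      CleanRegAt p (locAtCentre Ā'.toSubring Ō).subtype ū := by
  classical
  haveI : Fact p.Prime := ⟨hp⟩
  haveI : CharP κ p := charP_of_injective_algebraMap (algebraMap k κ).injective p
  -- the regular affine model `W = Spec A₁` over `k`
  haveI : Algebra.FiniteType k A₁ := A₁.fg_iff_finiteType.mp hA₁fg
  haveI : IsNoetherianRing A₁ := Algebra.FiniteType.isNoetherianRing k A₁
  haveI : IsDomain (CommRingCat.of A₁) := inferInstanceAs (IsDomain A₁)
  haveI : IsRegularRing (CommRingCat.of A₁) := hregA₁
  let W : Scheme.{0} := Spec (.of A₁)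
  let fW : W ⟶ Spec (.of k) := Spec.map (CommRingCat.ofHom (algebraMap k A₁))
  haveI : IsSeparated fW := inferInstance
  haveI : LocallyOfFiniteType fW := by
    rw [HasRingHomProperty.Spec_iff (P := @LocallyOfFiniteType)]
    exact RingHom.finiteType_algebraMap.mpr inferInstance
  haveI : QuasiCompact fW := inferInstance
  have hWreg : Scheme.IsRegular W := Scheme.isRegular_Spec (.of A₁)
  have hdimW : topologicalKrullDim W ≤ ((N : ℕ) : WithBot ℕ∞) := by
    change topologicalKrullDim (PrimeSpectrum A₁) ≤ ((N : ℕ) : WithBot ℕ∞)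
    rw [PrimeSpectrum.topologicalKrullDim_eq_ringKrullDim]
    exact hdimA₁
  -- the function field `F = K(W)` and its embedding `eF : F → κ`
  set F := W.functionField with hF
  haveI hWne : Nonempty (⊤ : W.Opens) := ⟨⟨genericPoint W, trivial⟩⟩
  haveI hfrF : IsFractionRing Γ(W, ⊤) F := functionField_isFractionRing_of_isAffineOpen W ⊤ (isAffineOpen_top W)
  let eΓ : Γ(W, ⊤) ≃+* A₁ := (Scheme.ΓSpecIso (.of A₁)).commRingCatIsoToRingEquiv
  let ιΓ : Γ(W, ⊤) →+* κ := (algebraMap A₁ κ).comp eΓ.toRingHom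
  have hιΓ : Function.Injective ιΓ := (IsFractionRing.injective A₁ κ).comp eΓ.injective
  let eF : F →+* κ := IsFractionRing.lift hιΓ
  have heF : ∀ s : Γ(W, ⊤), eF (algebraMap Γ(W, ⊤) F s) = algebraMap A₁ κ (eΓ s) := fun s =>
    IsFractionRing.lift_algebraMap hιΓ s
  have heFinj : Function.Injective eF := eF.injective
  haveI : CharP F p := eF.charP heFinj p
  haveI : ExpChar F p := ExpChar.prime hp
  -- `ū` read in `F`
  obtain ⟨a, ha⟩ : ∃ a : F, eF a = ū := by
    obtain ⟨n, d, hd, hnd⟩ := IsFractionRing.div_surjective (A := A₁) ū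
    refine ⟨algebraMap Γ(W, ⊤) F (eΓ.symm n) / algebraMap Γ(W, ⊤) F (eΓ.symm d), ?_⟩
    rw [map_div₀, heF, heF, RingEquiv.apply_symm_apply, RingEquiv.apply_symm_apply, hnd]
  have hanot : ∀ b : F, b ^ p ≠ a := fun b hb => hū (eF b) (by rw [← map_pow, hb, ha])
  -- `L = F(ū^{1/p})`
  haveI hirr : Fact (Irreducible (X ^ p - C a : F[X])) := ⟨(X_pow_sub_C_irreducible_iff_of_prime hp).mpr hanot⟩
  let L := AdjoinRoot (X ^ p - C a : F[X])
  haveI hPI : IsPurelyInseparable F L := by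
    rw [isPurelyInseparable_iff_pow_mem F p]
    intro x
    obtain ⟨s, hs⟩ := AdjoinRootFrame.exists_pow_eq p a x
    exact ⟨1, by rw [pow_one]; exact ⟨s, hs⟩⟩
  have hdeg : Module.finrank F L = p := by
    rw [(AdjoinRoot.powerBasis' (AdjoinRootFrame.monic p a)).finrank, AdjoinRootFrame.dim_eq]
  -- the clean model, from the restricted crux
  obtain ⟨V, π, hVint, hπdom, hprop, hbir, hVreg, hpt⟩ :=
    hCM p hp k W fW L inferInstance inferInstance inferInstance hWreg hPI hdeg hdimW
  -- extraction of a finitely generated model at the centre of `Ō`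
  have hAO : ∀ z : A₁, algebraMap A₁ κ z ∈ Ō := fun z => hA₁Ō z.2
  obtain ⟨x, T, hTO, hTfg, δ, Θ, hΘδ, hΘπ⟩ := exists_model_of_proper_birational Ō hAO π hprop hbir
  haveI := hVreg x
  haveI hregR' : IsRegularLocalRing (locAtCentre T.toSubring Ō) := IsRegularLocalRing.of_ringEquiv δ
  -- `Θ ∘ π^♯ = eF`
  have hΘeF : Θ.comp (RatFn.functionFieldMap π) = eF := by
    refine IsLocalization.ringHom_ext (nonZeroDivisors Γ(W, ⊤)) ?_
    ext s
    change Θ (RatFn.functionFieldMap π (algebraMap Γ(W, ⊤) F s)) = eF (algebraMap Γ(W, ⊤) F s)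
    rw [heF]
    exact hΘπ s
  -- the pointwise clause at `x`
  obtain ⟨y, g, hy, hg, hclause⟩ := hpt x
  have hLoose := (looseCleanForm_of_pointClause π x g hclause).map Θ
  have hLoose' : LooseCleanForm p (locAtCentre T.toSubring Ō).subtype (Θ (RatFn.functionFieldMap π g)) :=
    LooseCleanForm.of_ringEquiv δ (f := Θ.comp (algebraMap (V.presheaf.stalk x) V.functionField))
      (f' := (locAtCentre T.toSubring Ō).subtype) (fun r => (hΘδ r).symm) hLoose
  -- the coefficients: `y = Σ y_j θ^j`, `g = Σ y_j^p a^j`, `eF g = Σ (eF y_j)^p ū^j`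
  haveI : CharP L p := charP_of_injective_algebraMap (AdjoinRootFrame.algebraMap_injective p a) p
  let B := (AdjoinRoot.powerBasis' (AdjoinRootFrame.monic p a)).basis
  have hBdim : (AdjoinRoot.powerBasis' (AdjoinRootFrame.monic p a)).dim = p := AdjoinRootFrame.dim_eq p a
  let yc : Fin p → F := fun j => B.repr y (Fin.cast hBdim.symm j)
  have hBapply : ∀ j : Fin p, B (Fin.cast hBdim.symm j) = AdjoinRoot.root (X ^ p - C a : F[X]) ^ (j : ℕ) := by
    intro j
    change (AdjoinRoot.powerBasis' (AdjoinRootFrame.monic p a)).basis (Fin.cast hBdim.symm j) = _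
    rw [PowerBasis.coe_basis, AdjoinRoot.powerBasis'_gen]
    rfl
  have hysum : y = ∑ j : Fin p, yc j • AdjoinRoot.root (X ^ p - C a : F[X]) ^ (j : ℕ) := by
    have h1 := (B.sum_repr y).symm
    rw [← Equiv.sum_comp (finCongr hBdim.symm) (fun i => B.repr y i • B i)] at h1
    simp only [finCongr_apply, hBapply] at h1
    exact h1
  have hgsum : g = ∑ j : Fin p, yc j ^ p * a ^ (j : ℕ) := by
    apply AdjoinRootFrame.algebraMap_injective p a
    haveI : ExpChar L p := ExpChar.prime hp
    rw [hg, hysum, sum_pow_char p, map_sum]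
    refine Finset.sum_congr rfl fun j _ => ?_
    rw [_root_.smul_pow, ← pow_mul, mul_comm (j : ℕ) p, pow_mul, ← AdjoinRootFrame.root_pow p a, Algebra.smul_def,
      map_mul, map_pow, map_pow]
  let c : Fin p → κ := fun j => eF (yc j)
  have hG : Θ (RatFn.functionFieldMap π g) = ∑ j : Fin p, c j ^ p * ū ^ (j : ℕ) := by
    have : Θ (RatFn.functionFieldMap π g) = eF g := by rw [← hΘeF]; rfl
    rw [this, hgsum, map_sum]
    refine Finset.sum_congr rfl fun j _ => ?_
    rw [map_mul, map_pow, map_pow, ha]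
  have hc : ∃ j : Fin p, (j : ℕ) ≠ 0 ∧ c j ≠ 0 := by
    by_contra hcon
    push Not at hcon
    apply hy
    have hyc : ∀ j : Fin p, (j : ℕ) ≠ 0 → yc j = 0 := fun j hj => by
      have := hcon j hj
      exact (map_eq_zero_iff eF heFinj).mp this
    refine ⟨yc ⟨0, hp.pos⟩, ?_⟩
    rw [hysum, Finset.sum_eq_single ⟨0, hp.pos⟩]
    · simp [Algebra.smul_def, AdjoinRoot.algebraMap_eq]
      rfl
    · intro j _ hj
      rw [hyc j (fun h => hj (Fin.ext h)), zero_smul]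
    · intro h; exact absurd (Finset.mem_univ _) h
  have hclean : CleanRegAt p (locAtCentre T.toSubring Ō).subtype ū := ⟨hregR', c, hc, hG ▸ hLoose'⟩
  -- back to a finitely generated `k`-model
  obtain ⟨Ā', hĀ'O, hA₁Ā', hĀ'fg, hR'Ā'⟩ :=
    exists_model_of_isLocalBlowup (le_refl A₁) hA₁fg (isLocalBlowup_locAtCentre_adjoin Ō A₁ hA₁Ō T hTO hTfg)
  refine ⟨Ā', hĀ'O, hA₁Ā', hĀ'fg, ?_⟩
  rw [← hR'Ā']
  exact hclean

end Extraction

/-- **`CleanModels` restricted to `dim W ≤ N` ⟹ `CleanLUZeroDim_d` for every `d ≤ N`** — the skeleton's graded local input is NECESSARY for the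
crux, dimension by dimension: shrink the model to a regular affine one (`exists_regularAffineModel_of_regularAtCentre_dimLE`), extract along the
valuation (`cleanRegAt_of_cleanModelsDimLE_regularAffineModel`), unfold `CleanRegAt`.  The zero-dimensionality hypothesis of the graded shape is
not used. [folklore] -/
theorem cleanLUZeroDim_of_cleanModelsDimLE (N : ℕ)
    (hCM : ∀ p : ℕ, p.Prime → ∀ (k : Type) [Field k] [CharP k p] (W : AlgebraicGeometry.Scheme.{0}) [AlgebraicGeometry.IsIntegral W] (f : W ⟶ AlgebraicGeometry.Spec (.of k)) (L : Type) [Field L] [Algebra W.functionField L], AlgebraicGeometry.IsSeparated f → AlgebraicGeometry.LocallyOfFiniteType f → AlgebraicGeometry.QuasiCompact f → Literature.AlgebraicGeometry.Resolution.Scheme.IsRegular W → IsPurelyInseparable W.functionField L → Module.finrank W.functionField L = p → topologicalKrullDim W ≤ ((N : ℕ) : WithBot ℕ∞) → ∃ (V : AlgebraicGeometry.Scheme.{0}) (π : V ⟶ W) (_ : AlgebraicGeometry.IsIntegral V) (_ : AlgebraicGeometry.IsDominant π), AlgebraicGeometry.IsProper π ∧ Literature.AlgebraicGeometry.Resolution.IsBirational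 π ∧ Literature.AlgebraicGeometry.Resolution.Scheme.IsRegular V ∧ (∀ v : V, (∃ (y : L) (g : W.functionField), y ∉ Set.range (algebraMap W.functionField L) ∧ algebraMap W.functionField L g = y ^ p ∧ ((∃ (d m : ℕ) (hmd : m ≤ d) (t : Fin d → V.presheaf.stalk v) (a : Fin m → ℕ), Ideal.span (Set.range t) = IsLocalRing.maximalIdeal (V.presheaf.stalk v) ∧ ringKrullDim (V.presheaf.stalk v) = (d : WithBot ℕ∞) ∧ 0 < m ∧ (∀ i, ¬ p ∣ a i) ∧ Literature.AlgebraicGeometry.Motives.RatFn.functionFieldMap π g = ∏ i : Fin m, (algebraMap (V.presheaf.stalk v) V.functionField (t (Fin.castLE hmd i))) ^ (a i)) ∨ (∃ u₀ : V.presheaf.stalk v, IsUnit u₀ ∧ Literature.AlgebraicGeometry.Motives.RatFn.functionFieldMap π g = algebraMap (V.presheaf.stalk v) V.functionField u₀ ∧ ((∀ c : V.presheaf.stalk v, u₀ - c ^ p ∉ IsLocalRing.maximalIdeal (V.presheaf.stalk v)) ∨ (∃ c : V.presheaf.stalk v, u₀ - c ^ p ∈ IsLocalRing.maximalIdeal (V.presheaf.stalk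 v) ∧ u₀ - c ^ p ∉ IsLocalRing.maximalIdeal (V.presheaf.stalk v) ^ 2))))))) :
    ∀ d : ℕ, d ≤ N → ∀ (p : ℕ), p.Prime →
    ∀ (k : Type) [Field k] [CharP k p] (K : Type) [Field K] [Algebra k K]
    (O : ValuationSubring K) (A : Subalgebra k K), A.toSubring ≤ O.toSubring → A.FG → IsFractionRing A K →
    ringKrullDim A ≤ (d : WithBot ℕ∞) → IsRegularLocalRing (locAtCentre A.toSubring O) →
    ringKrullDim (locAtCentre A.toSubring O) = (d : WithBot ℕ∞) →
    (∀ (T : Subring K) (hT : T ≤ O.toSubring), A.toSubring ≤ T → (subringCentre T O hT).IsMaximal) →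
    ∀ g₀ : K, (∀ c : K, c ^ p ≠ g₀) →
    ∃ (A' : Subalgebra k K), A'.toSubring ≤ O.toSubring ∧ A ≤ A' ∧ A'.FG ∧
    ∃ (_ : IsRegularLocalRing (locAtCentre A'.toSubring O)) (c : Fin p → K), (∃ j : Fin p, (j : ℕ) ≠ 0 ∧ c j ≠ 0) ∧
    ((∃ (d m : ℕ) (hmd : m ≤ d) (t : Fin d → ↥(locAtCentre A'.toSubring O)) (a : Fin m → ℕ) (u : ↥(locAtCentre A'.toSubring O)), IsUnit u ∧
    Ideal.span (Set.range t) = IsLocalRing.maximalIdeal ↥(locAtCentre A'.toSubring O) ∧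
    ringKrullDim ↥(locAtCentre A'.toSubring O) = (d : WithBot ℕ∞) ∧ 0 < m ∧ (∀ i, ¬ p ∣ a i) ∧
    (∑ j : Fin p, c j ^ p * g₀ ^ (j : ℕ)) = (u : K) * ∏ i : Fin m, ((t (Fin.castLE hmd i) : ↥(locAtCentre A'.toSubring O)) : K) ^ (a i)) ∨
    (∃ u : ↥(locAtCentre A'.toSubring O), IsUnit u ∧ (∑ j : Fin p, c j ^ p * g₀ ^ (j : ℕ)) = (u : K) ∧
    ∀ c' : ↥(locAtCentre A'.toSubring O), u - c' ^ p ∉ IsLocalRing.maximalIdeal ↥(locAtCentre A'.toSubring O)) ∨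
    (∃ s c' : ↥(locAtCentre A'.toSubring O), (∑ j : Fin p, c j ^ p * g₀ ^ (j : ℕ)) = (s : K) ∧
    s - c' ^ p ∈ IsLocalRing.maximalIdeal ↥(locAtCentre A'.toSubring O) ∧
    s - c' ^ p ∉ IsLocalRing.maximalIdeal ↥(locAtCentre A'.toSubring O) ^ 2)) := by
  intro d hdN p hp k _ _ K _ _ O A hAO hAfg hfrac hdimA hreg _hdim _hzd g₀ hg₀
  obtain ⟨A₁, hA₁O, hAA₁, hA₁fg, hfr₁, hregA₁, hA₁dim⟩ :=
    exists_regularAffineModel_of_regularAtCentre_dimLE p hp O A hAO hAfg hfrac hreg hdimA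
  haveI := hfr₁
  have hA₁dimN : ringKrullDim A₁ ≤ ((N : ℕ) : WithBot ℕ∞) := hA₁dim.trans (by exact_mod_cast hdN)
  obtain ⟨Ā', hĀ'O, hA₁Ā', hĀ'fg, hreg', c, hc, hform⟩ :=
    cleanRegAt_of_cleanModelsDimLE_regularAffineModel N hCM p hp O A₁ hA₁O hA₁fg hregA₁ hA₁dimN g₀ hg₀
  refine ⟨Ā', hĀ'O, hAA₁.trans hA₁Ā', hĀ'fg, hreg', c, hc, ?_⟩
  rcases hform with ⟨d', m, hmd, t, a, u, hu, hspan, hdim', hm, ha, hX⟩ | ⟨u, hu, hX, hc'⟩ | ⟨s, c', hX, h1, h2⟩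
  · refine Or.inl ⟨d', m, hmd, t, a, u, hu, hspan, hdim', hm, ha, ?_⟩
    rw [hX, Subring.subtype_apply]
    push_cast
    rfl
  · exact Or.inr (Or.inl ⟨u, hu, hX, hc'⟩)
  · exact Or.inr (Or.inr ⟨s, c', hX, h1, h2⟩)

end Summit.ResolutionOfSingularities.ResolutionOfSingularities.Theorems.RadicialJung.CleanModels

end
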